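import Literature.NumberTheory.Rogawski1990.LocalStableClassesNonsplitScalarFrameKappa
import Literature.NumberTheory.Rogawski1990.KottwitzSignDiagonalModel
import Literature.NumberTheory.Rogawski1990.LocalStableClassesNonsplit
import Literature.NumberTheory.Rogawski1990.OccurrenceRealisationTwoForms
import Literature.NumberTheory.Automorphic.QuadraticLocalNormGroupNonsplit
import HarnessLib

/-!
# The SECOND class at the scalar partner `γ_H = (e·1₂, u)` EXISTS and carries the opposite sign: `∃ ε′ ↔ ι_v(γ_H)`, `ε′ ≁ ε`, `κ_v(γ_H, ε′) = −κ_v(γ_H, ε)`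
# (Rogawski 1990, §3.3 Prop. 3.3.1, §3.5 Prop. 3.5.2 (a), §3.8 Prop. 3.8.1 (d); proof of Prop. 8.2.1: «the two classes `ε`, `ε′`»)

Topic `NumberTheory/Rogawski1990`; namespace `Literature.NumberTheory.Rogawski1990`.  **THEOREMS ONLY** (no definition, no named fact, no instance,
no notation, no `sorry`).  Cell `pub/hodgecm-mathlib`, programme P3a, road «N6nsGerm» (crux H413), brick (K-e) = the EXISTENCE half of binder B2 «the two
classes over the scalar partner» of the S1 junction (the enumeration half «two matches with equal `κ_v` are conjugate» is ★
`LocalStableClassesNonsplitScalarFrameKappa`).  The scalar-block twin of B-p14's ★ type-(2) `exists_isStablyConj_finKappaAt_eq_neg`.  Seat A-p17 (g21).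
HONEST LABEL: HC_CM is proved only modulo the printed citations until rung 0 closes; this file is unconditional local algebra.

THE MATHEMATICS.  `v` non-split, `ε = g ι(γ_H) g⁻¹ ∈ U(H′_v)(F_v)` a match of the scalar partner.  In the transposition frame `P₀` (★ §1 of the kappa file)
`ᵗ(σP₀) H′_g P₀ = G₁ ⊕ᶠ G₂`.  Pick a `σ`-fixed unit `ζ` of `E_v` which is NOT a norm (★ `exists_conjLocal_eq_not_exists_norm`, index two) and the CARTAN CLASS
`x := P₀ (G₁⁻¹K ⊕ᶠ ζ·1₁) P₀⁻¹` with `K = diag(1, ζ·det G₁)`: `x` commutes with `ι(γ_H) = P₀ (e·1₂ ⊕ᶠ u·1₁) P₀⁻¹`, `H′_g · x` is hermitian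
(`K ⊕ᶠ ζG₂` in the frame) and `det x = ζ² = σ(ζ) ζ` is a norm; so ★ `exists_twistGram_eq_mul_iff_det` (local realisation, [Prop. 3.3.1] at one place)
gives `g₁` with `H′_{g g₁} = H′_g · x`, ★ `conj_mem_unitaryGroup_of_twistGram_eq_mul₂` lands `ε′ := (g g₁) ι(γ_H) (g g₁)⁻¹ ∈ U(H′_v)(F_v)`, and its
rank-one Gram corner is `ζ · G₂`: by the eigenframe reading ★ `finKappaAt_eq_ite_twistGram_eigenframe` and index two, `κ_v(γ_H, ε′) = −κ_v(γ_H, ε)`,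
hence `ε′ ≁ ε` (★ `finKappaAt_eq_of_isConj`).

* **`exists_isLocalNormPair_finKappaAt_eq_neg_of_fst_eq_smul_one`** — `∃ ε′, ι_v(γ_H) ↔ ε′ ∧ ε ≁ ε′ ∧ κ_v(γ_H, ε′) = −κ_v(γ_H, ε)`;
  `exists_isLocalNormPair_finExplicitDelta_eq_neg_of_fst_eq_smul_one` — the same with `Δ‴_v(γ_H, ε′) = −Δ‴_v(γ_H, ε)`.

## References
* [Rogawski1990] J. D. Rogawski, *Automorphic Representations of Unitary Groups in Three Variables*, Ann. of Math. Stud. 123 (1990), §3.3 Prop. 3.3.1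
  p. 22, §3.5 Prop. 3.5.2 (a)(c) p. 29, §3.8 Prop. 3.8.1 (d) p. 30, §4.3 (4.3.2) p. 43, §8.2 Prop. 8.2.1 (a)(d) pp. 118–122.
* [Kottwitz1986] R. E. Kottwitz, *Stable trace formula: elliptic singular terms*, Math. Ann. 275 (1986), §7.
* [Omeara1963] O. T. O'Meara, *Introduction to Quadratic Forms* (1963), §63B Prop. 63:13 (index two of the local norm group).
-/

set_option autoImplicit false

noncomputable section

open NumberField IsDedekindDomain Matrix
open scoped MatrixGroups

namespace Literature.NumberTheory.Rogawski1990

open Literature.NumberTheory.Automorphic Literature.NumberTheory.Automorphic.UnitaryGroup Literature.NumberTheory.GaloisRepresentations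
open Literature.AlgebraicGeometry.ShimuraVarieties (unitaryGroup mem_unitaryGroup_iff)

/-! ## §1 Ring-generic plumbing -/

section Generic

variable {S : Type*} [CommRing S] (σ : S →+* S) {N₁ N₂ : ℕ}

omit σ in
/-- `(A ⊕ᶠ B)(C ⊕ᶠ D) = AC ⊕ᶠ BD`. [folklore] -/
private theorem finSum_mul_finSum₆ (A C : Matrix (Fin N₁) (Fin N₁) S) (B D : Matrix (Fin N₂) (Fin N₂) S) :
    finSum N₁ N₂ A B * finSum N₁ N₂ C D = finSum N₁ N₂ (A * C) (B * D) := by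
  simp only [finSum, Matrix.reindex_apply, Matrix.submatrix_mul_equiv, Matrix.fromBlocks_multiply, Matrix.mul_zero, Matrix.zero_mul,
    add_zero, zero_add]

omit σ in
/-- `⊕ᶠ` is injective on blocks. [folklore] -/
private theorem finSum_inj₆ {A C : Matrix (Fin N₁) (Fin N₁) S} {B D : Matrix (Fin N₂) (Fin N₂) S} (h : finSum N₁ N₂ A B = finSum N₁ N₂ C D) :
    A = C ∧ B = D := by
  have h' := (Matrix.reindex finSumFinEquiv finSumFinEquiv).injective h
  rw [Matrix.fromBlocks_inj] at h'
  exact ⟨h'.1, h'.2.2.2⟩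

/-- The blocks of a hermitian block-diagonal matrix are hermitian. [folklore] -/
private theorem blocks_hermitian₆ {G₁ : Matrix (Fin N₁) (Fin N₁) S} {G₂ : Matrix (Fin N₂) (Fin N₂) S}
    (h : ((finSum N₁ N₂ G₁ G₂).map σ)ᵀ = finSum N₁ N₂ G₁ G₂) : (G₁.map σ)ᵀ = G₁ ∧ (G₂.map σ)ᵀ = G₂ := by
  rw [transpose_finSum_map] at h
  exact finSum_inj₆ h

omit σ in
/-- The `(inr i, inr j)` entry of `A ⊕ᶠ B` is `B i j`. [folklore] -/
private theorem finSum_apply_inr₆ (A : Matrix (Fin N₁) (Fin N₁) S) (B : Matrix (Fin N₂) (Fin N₂) S) (i j : Fin N₂) :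
    finSum N₁ N₂ A B (finSumFinEquiv (Sum.inr i)) (finSumFinEquiv (Sum.inr j)) = B i j := by
  rw [finSum, reindex_apply, submatrix_apply, Equiv.symm_apply_apply, Equiv.symm_apply_apply, fromBlocks_apply₂₂]

omit σ in
/-- The transposition matrix `(e₁ e₃ e₂)` is an involution. [folklore] -/
private theorem swapMatrix_mul_self₆ : (!![1, 0, 0; 0, 0, 1; 0, 1, 0] : Matrix (Fin 3) (Fin 3) S) * !![1, 0, 0; 0, 0, 1; 0, 1, 0] = 1 := by
  rw [Matrix.one_fin_three]
  ext i j; fin_cases i <;> fin_cases j <;> simp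

omit σ in
/-- `diag(e, u, e) · (e₁ e₃ e₂) = (e₁ e₃ e₂) · diag(e, e, u)`. [folklore] -/
private theorem diag_mul_swapMatrix₆ (e u : S) :
    (!![e, 0, 0; 0, u, 0; 0, 0, e] : Matrix (Fin 3) (Fin 3) S) * !![1, 0, 0; 0, 0, 1; 0, 1, 0] = !![1, 0, 0; 0, 0, 1; 0, 1, 0] * !![e, 0, 0; 0, e, 0; 0, 0, u] := by
  ext i j; fin_cases i <;> fin_cases j <;> simp

omit σ in
/-- `e·1₂ ⊕ᶠ u·1₁ = diag(e, e, u)` as an explicit `3 × 3` matrix. [folklore] -/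
private theorem finSum_two_one_smul_one₆ (e u : S) :
    finSum 2 1 (e • (1 : Matrix (Fin 2) (Fin 2) S)) (u • (1 : Matrix (Fin 1) (Fin 1) S)) = !![e, 0, 0; 0, e, 0; 0, 0, u] := by
  rw [finSum_smul_one_eq_diagonal]
  ext i j; fin_cases i <;> fin_cases j <;> simp [diagonal]

omit σ in
/-- A `1 × 1` matrix whose entry is `σ`-fixed is hermitian. [folklore] -/
private theorem hermitian_of_fin_one₆ (σ' : S →+* S) {M : Matrix (Fin 1) (Fin 1) S} (h : σ' (M 0 0) = M 0 0) : (M.map σ')ᵀ = M := by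
  ext i j
  obtain rfl : i = 0 := Subsingleton.elim _ _
  obtain rfl : j = 0 := Subsingleton.elim _ _
  rw [transpose_apply, map_apply, h]

omit σ in
/-- Opposite signs from incompatible norm tests. [folklore] -/
private theorem ite_eq_neg_ite_of_not_iff₆ (p q : Prop) [Decidable p] [Decidable q] (h : ¬ (p ↔ q)) :
    (if p then (1 : ℤ) else -1) = -(if q then 1 else -1) := by
  by_cases hp : p <;> by_cases hq : q <;> simp_all

end Generic

/-! ## §2 The second class at the scalar partner -/

section CM

variable (L : Type) [Field L] [NumberField L] [IsCMField L] (v : HeightOneSpectrum (𝓞 ↥(maximalRealSubfield L)))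
  (H' : Matrix (Fin 3) (Fin 3) L)
  (a : (UnitaryGroup.cmDatum L 2 (Matrix.of fun i j : Fin 2 => if i.val + j.val + 1 = 2 then (1 : L) else 0)).Local v ×
      (UnitaryGroup.cmDatum L 1 (Matrix.of fun i j : Fin 1 => if i.val + j.val + 1 = 1 then (1 : L) else 0)).Local v)
  (b : (UnitaryGroup.cmDatum L 3 H').Local v)

/-- A CM field has a non-zero element negated by complex conjugation. [cite: Rogawski1990, §1.10] -/
private theorem exists_complexConj_eq_neg_ne_zero₆ : ∃ δ : L, IsCMField.complexConj L δ = -δ ∧ δ ≠ 0 := by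
  obtain ⟨ζ, hζ⟩ := not_forall.1 fun h0 => IsCMField.complexConj_ne_one L (AlgEquiv.ext h0)
  refine ⟨ζ - IsCMField.complexConj L ζ, by rw [map_sub, IsCMField.complexConj_apply_apply, neg_sub], fun h0 => hζ ?_⟩
  rw [sub_eq_zero] at h0
  exact h0.symm

set_option maxHeartbeats 800000 in -- many `GL₃(∏_w L_w)`-level unifications; each is cheap, the sum is not
open scoped Classical in
/-- **THE SECOND CLASS AT THE SCALAR PARTNER EXISTS AND FLIPS THE SIGN** (non-split `v`, one place `w`, `c • w = w`): for `γ_H = (e·1₂, u)` with `(u − e)²` a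
unit and a match `ε = b ↔ ι_v(γ_H)` in `U(H′_v)(F_v)` there is a second match `ε′` with `ε ≁ ε′` in `U(H′_v)(F_v)` and `κ_v(γ_H, ε′) = −κ_v(γ_H, ε)` — the
Cartan class `P₀ (G₁⁻¹ diag(1, ζ det G₁) ⊕ᶠ ζ) P₀⁻¹` of a NON-NORM `ζ` has norm determinant `ζ²`, so it is realised (★ `exists_twistGram_eq_mul_iff_det`,
[Prop. 3.3.1] at one place) inside `U(H′_v)` (★ `conj_mem_unitaryGroup_of_twistGram_eq_mul₂`), with rank-one Gram corner `ζ G₂` of the other norm class.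
[cite: Rogawski1990, §3.3 Prop. 3.3.1 p. 22; §3.5 Prop. 3.5.2 (a)(c) p. 29; §3.8 Prop. 3.8.1 (d) p. 30; §4.3 (4.3.2) p. 43] [cite: Kottwitz1986, §7]
[cite: Omeara1963, §63B Prop. 63:13] -/
theorem exists_isLocalNormPair_finKappaAt_eq_neg_of_fst_eq_smul_one (w : UnitaryGroup.PlacesOver L v) (hw : IsCMField.complexConj L • w.1 = w.1)
    (h : IsLocalNormPair L H' v a b) (hu : IsUnit ((finCharpolyTwo L v a).eval (finGammaTwo L v a)))
    (hH : (((UnitaryGroup.adelicForm L 3 H').map (UnitaryGroup.adeleToLocal L v)).map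
      (UnitaryGroup.conjLocal L (IsCMField.complexConj L) v))ᵀ = (UnitaryGroup.adelicForm L 3 H').map (UnitaryGroup.adeleToLocal L v))
    (hHd : IsUnit ((UnitaryGroup.adelicForm L 3 H').map (UnitaryGroup.adeleToLocal L v)).det)
    {e : UnitaryGroup.LocalRing L v} (ha : (a.1.val.val : Matrix (Fin 2) (Fin 2) (UnitaryGroup.LocalRing L v)) = e • (1 : Matrix (Fin 2) (Fin 2) _)) :
    ∃ b' : (UnitaryGroup.cmDatum L 3 H').Local v, IsLocalNormPair L H' v a b' ∧
      ¬ IsConj (⟨b.val, b.2⟩ : unitaryGroup (UnitaryGroup.conjLocal L (IsCMField.complexConj L) v)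
          ((UnitaryGroup.adelicForm L 3 H').map (UnitaryGroup.adeleToLocal L v))) ⟨b'.val, b'.2⟩ ∧
      finKappaAt L v H' a b' = -finKappaAt L v H' a b := by
  classical
  obtain ⟨δ, hcδ, hδ⟩ := exists_complexConj_eq_neg_ne_zero₆ L
  haveI : Algebra.IsQuadraticExtension ↥(maximalRealSubfield L) L := IsCMField.isQuadraticExtension L
  have hσσ : ∀ s, UnitaryGroup.conjLocal L (IsCMField.complexConj L) v (UnitaryGroup.conjLocal L (IsCMField.complexConj L) v s) = s :=
    Liu2021.LemD1OfPlace.conjLocal_conjLocal_apply L v (IsCMField.complexConj L) hcδ hδ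
  have hv : Subsingleton (UnitaryGroup.PlacesOver L v) :=
    UnitaryGroup.PlacesOver.subsingleton_of_smul_eq (IsCMField.complexConj L) (IsCMField.complexConj_ne_one L) w hw
  set σ := UnitaryGroup.conjLocal L (IsCMField.complexConj L) v with hσdef
  set Hv := (UnitaryGroup.adelicForm L 3 H').map (UnitaryGroup.adeleToLocal L v) with hHvdef
  set u := finGammaTwo L v a with hudef
  -- norm-one scalars and the unit `e − u`
  have he1 : σ e * e = 1 := conjLocal_mul_self_of_fst_eq_smul_one L v a ha
  have hu1 : σ u * u = 1 := conjLocal_finGammaTwo_mul_finGammaTwo L v a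
  have heu : IsUnit (e - u) := by
    have h2 : IsUnit ((u - e) ^ 2) := by rw [← eval_finCharpolyTwo_of_fst_eq_smul_one L v a ha]; exact hu
    rw [← neg_sub]
    exact ((isUnit_pow_iff two_ne_zero).1 h2).neg
  -- `ι_v(γ_H) = diag(e, u, e)` and its transposition frame
  set γ₀ : GL (Fin 3) (UnitaryGroup.LocalRing L v) := (endoEmbLocal L v a).val with hγ₀
  have hι : (γ₀.val : Matrix (Fin 3) (Fin 3) (UnitaryGroup.LocalRing L v)) = !![e, 0, 0; 0, u, 0; 0, 0, e] := by
    rw [hγ₀, coe_endoEmbLocal, coe_endoGL_eq, ha]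
    exact scalar_endoPattern_eq e u
  set P₀m : Matrix (Fin 3) (Fin 3) (UnitaryGroup.LocalRing L v) := !![1, 0, 0; 0, 0, 1; 0, 1, 0] with hP₀m
  have hP₀P₀ : P₀m * P₀m = 1 := swapMatrix_mul_self₆
  set P₀ : GL (Fin 3) (UnitaryGroup.LocalRing L v) := ⟨P₀m, P₀m, hP₀P₀, hP₀P₀⟩ with hP₀
  have hP₀val : P₀.val = P₀m := rfl
  set D := finSum 2 1 (e • (1 : Matrix (Fin 2) (Fin 2) (UnitaryGroup.LocalRing L v))) (u • (1 : Matrix (Fin 1) (Fin 1) (UnitaryGroup.LocalRing L v)))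
    with hD
  have hDdiag : D = diagonal ![e, e, u] := finSum_smul_one_eq_diagonal e u
  set j : Fin 3 := finSumFinEquiv (m := 2) (n := 1) (Sum.inr 0) with hjdef
  have hj2 : j = 2 := by rw [hjdef]; decide
  have hj : (![e, e, u] : Fin 3 → UnitaryGroup.LocalRing L v) j = finGammaTwo L v a := by
    rw [hj2, hudef]; rfl
  have hDexp : D = !![e, 0, 0; 0, e, 0; 0, 0, u] := finSum_two_one_smul_one₆ e u
  have hframe : γ₀.val * P₀.val = P₀.val * D := by
    rw [hι, hP₀val, hDexp]
    exact diag_mul_swapMatrix₆ e u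
  have hγ₀eq : γ₀.val = P₀m * D * P₀m := by
    calc γ₀.val = γ₀.val * P₀.val * P₀m := by rw [hP₀val, Matrix.mul_assoc, hP₀P₀, Matrix.mul_one]
      _ = P₀m * D * P₀m := by rw [hframe, hP₀val]
  -- the conjugator of `b`
  obtain ⟨g, hg⟩ := isConj_iff.1 ((isLocalNormPair_iff L H' v a b).1 h)
  rw [← hγ₀] at hg
  have hgγ : g.val * γ₀.val = b.val.val * g.val := by
    rw [← Units.val_mul, ← Units.val_mul, ← hg, inv_mul_cancel_right]
  -- `ι(γ_H)` is unitary for `H′_g`, whose Gram matrix in the frame is `G₁ ⊕ᶠ G₂`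
  have hγ₀g : γ₀ ∈ unitaryGroup σ (twistGram σ Hv g.val) := by
    rw [Literature.AlgebraicGeometry.ShimuraVarieties.mem_unitaryGroup_iff, ← twistGram_mul, hgγ, twistGram_unitary_mul σ Hv b.2]
  obtain ⟨G₁, G₂, hGP⟩ := exists_twistGram_eq_finSum_of_scalar_frame (N₁ := 2) (N₂ := 1) σ hγ₀g hframe he1 hu1 heu
  have hHg : ((twistGram σ Hv g.val).map σ)ᵀ = twistGram σ Hv g.val := conjTranspose_twistGram σ Hv hσσ hH g.val
  have hdetg : IsUnit g.val.det := Matrix.isUnits_det_units g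
  have hHgd : IsUnit (twistGram σ Hv g.val).det := by
    rw [det_twistGram]; exact ((hdetg.map σ).mul hHd).mul hdetg
  have hT : ((finSum 2 1 G₁ G₂).map σ)ᵀ = finSum 2 1 G₁ G₂ := by
    rw [← hGP]; exact conjTranspose_twistGram σ _ hσσ hHg P₀.val
  obtain ⟨hG₁h, hG₂h⟩ := blocks_hermitian₆ σ hT
  have hdetP : P₀m.det * P₀m.det = 1 := by rw [← Matrix.det_mul, hP₀P₀, Matrix.det_one]
  have hdetPu : IsUnit P₀m.det := IsUnit.of_mul_eq_one _ hdetP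
  have hdT : G₁.det * G₂ 0 0 = σ P₀m.det * (twistGram σ Hv g.val).det * P₀m.det := by
    rw [← Matrix.det_fin_one G₂, ← det_finSum, ← hGP, hP₀val, det_twistGram]
  have hTu : IsUnit (G₁.det * G₂ 0 0) := by rw [hdT]; exact ((hdetPu.map σ).mul hHgd).mul hdetPu
  have hG₁d : IsUnit G₁.det := isUnit_of_mul_isUnit_left hTu
  have hG₂u : IsUnit (G₂ 0 0) := isUnit_of_mul_isUnit_right hTu
  have hσG₁ : σ G₁.det = G₁.det := by
    conv_rhs => rw [← hG₁h]
    rw [Matrix.det_transpose, ← RingHom.mapMatrix_apply, RingHom.map_det]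
  have hσG₂ : σ (G₂ 0 0) = G₂ 0 0 := by
    have hc := congrFun (congrFun hG₂h 0) 0
    rwa [transpose_apply, map_apply] at hc
  -- a non-norm `σ`-fixed unit and the Cartan class
  obtain ⟨ζ, hζσ, hζu, hζn⟩ := exists_conjLocal_eq_not_exists_norm L v (IsCMField.complexConj L) hcδ hδ w hw
  set K : Matrix (Fin 2) (Fin 2) (UnitaryGroup.LocalRing L v) := diagonal ![1, ζ * G₁.det] with hK
  set y₁ : Matrix (Fin 2) (Fin 2) (UnitaryGroup.LocalRing L v) := G₁⁻¹ * K with hy₁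
  set Y := finSum 2 1 y₁ (ζ • (1 : Matrix (Fin 1) (Fin 1) (UnitaryGroup.LocalRing L v))) with hY
  set x : Matrix (Fin 3) (Fin 3) (UnitaryGroup.LocalRing L v) := P₀m * Y * P₀m with hx
  have hG₁y₁ : G₁ * y₁ = K := by rw [hy₁, ← Matrix.mul_assoc, Matrix.mul_nonsing_inv _ hG₁d, Matrix.one_mul]
  have hKh : (K.map σ)ᵀ = K := by
    rw [hK, diagonal_map (map_zero σ), diagonal_transpose]
    congr 1
    funext i; fin_cases i
    · exact map_one σ
    · show σ (ζ * G₁.det) = ζ * G₁.det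
      rw [map_mul, hζσ, hσG₁]
  have hζG₂h : ((G₂ * (ζ • (1 : Matrix (Fin 1) (Fin 1) (UnitaryGroup.LocalRing L v)))).map σ)ᵀ = G₂ * (ζ • 1) := by
    refine hermitian_of_fin_one₆ σ ?_
    rw [Matrix.mul_smul, Matrix.mul_one, Matrix.smul_apply, smul_eq_mul, map_mul, hζσ, hσG₂]
  have hTY : finSum 2 1 G₁ G₂ * Y = finSum 2 1 K (G₂ * (ζ • 1)) := by rw [hY, finSum_mul_finSum₆, hG₁y₁]
  have hTYh : ((finSum 2 1 K (G₂ * (ζ • (1 : Matrix (Fin 1) (Fin 1) (UnitaryGroup.LocalRing L v))))).map σ)ᵀ = finSum 2 1 K (G₂ * (ζ • 1)) := by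
    rw [transpose_finSum_map, hKh, hζG₂h]
  -- `H′_g = ᵗ(σP₀) (G₁ ⊕ᶠ G₂) P₀` and `H′_g · x = ᵗ(σP₀) (K ⊕ᶠ ζG₂) P₀`
  have hHgT : twistGram σ Hv g.val = twistGram σ (finSum 2 1 G₁ G₂) P₀m := by
    rw [← hGP, hP₀val, twistGram_def σ (twistGram σ (twistGram σ Hv g.val) P₀m) P₀m, ← twistGram_mul, hP₀P₀, twistGram_one]
  have hHgx : twistGram σ Hv g.val * x = twistGram σ (finSum 2 1 K (G₂ * (ζ • 1))) P₀m := by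
    rw [hHgT, hx, twistGram_def, twistGram_def, ← hTY]
    simp only [Matrix.mul_assoc]
    rw [← Matrix.mul_assoc P₀m P₀m, hP₀P₀, Matrix.one_mul]
  have hHxh : ((twistGram σ Hv g.val * x).map σ)ᵀ = twistGram σ Hv g.val * x := by
    rw [hHgx]; exact conjTranspose_twistGram σ _ hσσ hTYh P₀m
  have hxs : hermStar σ (twistGram σ Hv g.val) x = x := (conjTranspose_mul_eq_self_iff σ _ hHg hHgd x).1 hHxh
  -- `x` commutes with `ι(γ_H)` (both block diagonal in the frame, one with scalar blocks)
  have hDY : D * Y = Y * D := by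
    rw [hD, hY, finSum_mul_finSum₆, finSum_mul_finSum₆, smul_mul_assoc, Matrix.one_mul, mul_smul_comm, Matrix.mul_one,
      smul_mul_assoc, Matrix.one_mul, mul_smul_comm, Matrix.mul_one, smul_comm ζ u]
  have hxγ : Commute x γ₀.val := by
    show x * γ₀.val = γ₀.val * x
    rw [hγ₀eq, hx]
    calc P₀m * Y * P₀m * (P₀m * D * P₀m) = P₀m * Y * (P₀m * P₀m) * D * P₀m := by simp only [Matrix.mul_assoc]
      _ = P₀m * (Y * D) * P₀m := by rw [hP₀P₀, Matrix.mul_one]; simp only [Matrix.mul_assoc]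
      _ = P₀m * (D * Y) * P₀m := by rw [hDY]
      _ = P₀m * D * (P₀m * P₀m) * Y * P₀m := by rw [hP₀P₀, Matrix.mul_one]; simp only [Matrix.mul_assoc]
      _ = P₀m * D * P₀m * (P₀m * Y * P₀m) := by simp only [Matrix.mul_assoc]
  -- `det x = ζ² = σ(ζ) ζ` is a norm
  have hdetK : K.det = ζ * G₁.det := by rw [hK, det_diagonal]; simp
  have hdety₁ : y₁.det = ζ := by
    rw [hy₁, Matrix.det_mul, hdetK, Matrix.det_nonsing_inv, mul_comm ζ, ← mul_assoc, Ring.inverse_mul_cancel _ hG₁d, one_mul]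
  have hdetx : x.det = σ ζ * ζ := by
    rw [hx, Matrix.det_mul, Matrix.det_mul, hY, det_finSum, hdety₁, Matrix.det_smul, Matrix.det_one, mul_one, Fintype.card_fin, pow_one, hζσ]
    linear_combination (ζ * ζ) * hdetP
  have hxd : IsUnit x.det := by rw [hdetx]; exact (hζu.map σ).mul hζu
  -- realisation inside `U(H′_g)`, then in `U(H′_v)` with the conjugator `g g₁`
  obtain ⟨g₁, hg₁⟩ := (exists_twistGram_eq_mul_iff_det L v (IsCMField.complexConj L) hcδ hδ w hw hHg hHgd hxs hxd).2 ⟨ζ, hζu, hdetx⟩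
  have hg₂ : twistGram σ Hv (g * g₁).val = twistGram σ Hv g.val * x := by rw [Units.val_mul, twistGram_mul, ← twistGram_def, hg₁]
  have hmem : g * g₁ * γ₀ * (g * g₁)⁻¹ ∈ unitaryGroup σ Hv :=
    conj_mem_unitaryGroup_of_twistGram_eq_mul₂ σ (twistGram σ Hv g.val) Hv hγ₀g hxγ hg₂
  let b' : (UnitaryGroup.cmDatum L 3 H').Local v := ⟨g * g₁ * γ₀ * (g * g₁)⁻¹, hmem⟩
  have hb'val : b'.val = g * g₁ * γ₀ * (g * g₁)⁻¹ := rfl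
  have hbb' : (g * g₁ * g⁻¹) * b.val * (g * g₁ * g⁻¹)⁻¹ = b'.val := by
    rw [hb'val, ← hg, _root_.mul_inv_rev, _root_.mul_inv_rev, inv_inv]
    simp only [mul_assoc, inv_mul_cancel_left]
  have h' : IsLocalNormPair L H' v a b' := isLocalNormPair_of_conj_eq L v H' a b b' h hbb'
  -- the two eigenframes `g P₀`, `g g₁ P₀` and their rank-one corners `G₂`, `ζ G₂`
  have hPg : (b.val.val : Matrix (Fin 3) (Fin 3) (UnitaryGroup.LocalRing L v)) * (g * P₀).val = (g * P₀).val * diagonal ![e, e, u] := by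
    rw [Units.val_mul, ← Matrix.mul_assoc, ← hgγ, Matrix.mul_assoc, hframe, ← Matrix.mul_assoc, hDdiag]
  have hg₂γ : (g * g₁).val * γ₀.val = b'.val.val * (g * g₁).val := by
    rw [← Units.val_mul, ← Units.val_mul, hb'val, inv_mul_cancel_right]
  have hPg₂ : (b'.val.val : Matrix (Fin 3) (Fin 3) (UnitaryGroup.LocalRing L v)) * (g * g₁ * P₀).val = (g * g₁ * P₀).val * diagonal ![e, e, u] := by
    rw [Units.val_mul (g * g₁) P₀, ← Matrix.mul_assoc, ← hg₂γ, Matrix.mul_assoc, hframe, ← Matrix.mul_assoc, hDdiag]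
  have hκb := finKappaAt_eq_ite_twistGram_eigenframe L v H' a b hv h hu hPg hj
  have hκb' := finKappaAt_eq_ite_twistGram_eigenframe L v H' a b' hv h' hu hPg₂ hj
  have hF0 : twistGram σ Hv (g * P₀).val = finSum 2 1 G₁ G₂ := by
    rw [Units.val_mul, twistGram_mul, ← twistGram_def, hGP]
  have hF : twistGram σ Hv (g * g₁ * P₀).val = finSum 2 1 K (G₂ * (ζ • 1)) := by
    rw [Units.val_mul, twistGram_mul, ← twistGram_def, hg₂, hHgx, hP₀val,
      twistGram_def σ (twistGram σ (finSum 2 1 K (G₂ * (ζ • 1))) P₀m) P₀m, ← twistGram_mul, hP₀P₀, twistGram_one]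
  have hjj : twistGram σ Hv (g * P₀).val j j = G₂ 0 0 := by
    rw [hF0, hjdef, finSum_apply_inr₆]
  have hjj' : twistGram σ Hv (g * g₁ * P₀).val j j = G₂ 0 0 * ζ := by
    rw [hF, hjdef, finSum_apply_inr₆, Matrix.mul_smul, Matrix.mul_one, Matrix.smul_apply, smul_eq_mul, mul_comm]
  rw [hjj] at hκb
  rw [hjj'] at hκb'
  -- the norm tests are incompatible: `ζ` is not a norm
  have hincomp : ¬ ((∃ z : UnitaryGroup.LocalRing L v, IsUnit z ∧ G₂ 0 0 * ζ = z * σ z) ↔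
      (∃ z : UnitaryGroup.LocalRing L v, IsUnit z ∧ G₂ 0 0 = z * σ z)) := by
    intro hiff
    have hiff' : (∃ z : UnitaryGroup.LocalRing L v, IsUnit z ∧ G₂ 0 0 * ζ = σ z * z * 1) ↔
        (∃ z : UnitaryGroup.LocalRing L v, IsUnit z ∧ G₂ 0 0 = σ z * z * 1) := by
      refine Iff.trans ?_ (hiff.trans ?_)
      · exact exists_congr fun z => and_congr_right fun _ => by rw [mul_one, mul_comm (σ z)]
      · exact exists_congr fun z => and_congr_right fun _ => by rw [mul_one, mul_comm (σ z)]
    have hG₂ζσ : σ (G₂ 0 0 * ζ) = G₂ 0 0 * ζ := by rw [map_mul, hσG₂, hζσ]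
    obtain ⟨z, hz, hzz⟩ := (exists_norm_mul_iff_norm_tests_iff L v (IsCMField.complexConj L) hcδ hδ w hw hσG₂ hG₂u hG₂ζσ (hG₂u.mul hζu)
      (map_one σ) isUnit_one).2 hiff'
    refine hζn ⟨z, hz, (IsUnit.mul_right_inj hG₂u).1 ?_⟩
    rw [hzz]; ring
  have hκ : finKappaAt L v H' a b' = -finKappaAt L v H' a b := by
    rw [hκb, hκb']
    exact ite_eq_neg_ite_of_not_iff₆ _ _ hincomp
  -- hence not conjugate
  have hne : ¬ IsConj (⟨b.val, b.2⟩ : unitaryGroup σ Hv) ⟨b'.val, b'.2⟩ := by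
    intro hc
    obtain ⟨y, hy⟩ := isConj_iff.1 hc
    have heq : finKappaAt L v H' a b' = finKappaAt L v H' a b :=
      finKappaAt_eq_of_isConj L v H' a b h (isConj_iff.2 ⟨⟨y.val, y.2⟩, Subtype.ext (congrArg Subtype.val hy)⟩)
    have h0 := finKappaAt_ne_zero_of_isUnit L v H' a b h hu
    rw [heq] at hκ
    exact h0 (by linarith)
  exact ⟨b', h', hne, hκ⟩

open scoped Classical in
/-- **… and `Δ‴_v(γ_H, ε′) = −Δ‴_v(γ_H, ε)` for that second class** (★ `finExplicitDelta_eq_neg_of_not_isConj_of_fst_eq_smul_one`).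
[cite: Rogawski1990, §4.9 p. 55; §4.3 (4.3.2) p. 43; §8.2 Prop. 8.2.1 (a)(d) pp. 118–122] -/
theorem exists_isLocalNormPair_finExplicitDelta_eq_neg_of_fst_eq_smul_one (μ : HeckeCharacter L)
    (w : UnitaryGroup.PlacesOver L v) (hw : IsCMField.complexConj L • w.1 = w.1)
    (h : IsLocalNormPair L H' v a b) (hu : IsUnit ((finCharpolyTwo L v a).eval (finGammaTwo L v a)))
    (hH : (((UnitaryGroup.adelicForm L 3 H').map (UnitaryGroup.adeleToLocal L v)).map
      (UnitaryGroup.conjLocal L (IsCMField.complexConj L) v))ᵀ = (UnitaryGroup.adelicForm L 3 H').map (UnitaryGroup.adeleToLocal L v))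
    (hHd : IsUnit ((UnitaryGroup.adelicForm L 3 H').map (UnitaryGroup.adeleToLocal L v)).det)
    {e : UnitaryGroup.LocalRing L v} (ha : (a.1.val.val : Matrix (Fin 2) (Fin 2) (UnitaryGroup.LocalRing L v)) = e • (1 : Matrix (Fin 2) (Fin 2) _)) :
    ∃ b' : (UnitaryGroup.cmDatum L 3 H').Local v, IsLocalNormPair L H' v a b' ∧
      ¬ IsConj (⟨b.val, b.2⟩ : unitaryGroup (UnitaryGroup.conjLocal L (IsCMField.complexConj L) v)
          ((UnitaryGroup.adelicForm L 3 H').map (UnitaryGroup.adeleToLocal L v))) ⟨b'.val, b'.2⟩ ∧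
      finExplicitDelta L v H' a μ b' = -finExplicitDelta L v H' a μ b := by
  obtain ⟨b', h', hne, -⟩ := exists_isLocalNormPair_finKappaAt_eq_neg_of_fst_eq_smul_one L v H' a b w hw h hu hH hHd ha
  exact ⟨b', h', hne, finExplicitDelta_eq_neg_of_not_isConj_of_fst_eq_smul_one L v H' a b b' μ w hw h h' hu hH hHd ha hne⟩

end CM

end Literature.NumberTheory.Rogawski1990
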